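import Literature.MathematicalPhysics.QuantumFieldTheory.Balaban1983to89.B9Eq315QYSizeWeightedL2Y
import Literature.MathematicalPhysics.QuantumFieldTheory.Balaban1983to89.B9Eq315QLetterL2SizeFromClosenessY

/-!
# `Balaban1983to89.B9Thm311PosDefAveragingSwapClose` — T. Bałaban, *Propagators for lattice gauge theories in a background field*, Commun. Math. Phys. **99**
# (1985) 389–434 [Balaban1985BackgroundPropagators], THEOREM 3.11 p. 416 at the RE-PINNED averaging letter, CLOSENESS-ONLY FORM: `Δ_a^𝔮(U) > 0` on print's
# class (3.35) at section-carrying members from the adjointness of the pair `(𝔮, 𝔮*)`, ONE ℓ²-closeness of `𝔮(U)` to a (row-wise unitarily rebased) straight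
# averaging `Q(U)`, and ONE numeric inequality

statement-level skeleton of published theorems with citation tags; proofs where landed; nothing here is a claim about the Yang–Mills mass gap

THE PRINT.  (3.26) p. 395 (`Δ_a = Δ + DRD* + Q*aQ`); (3.12)–(3.13) p. 392, (3.14)–(3.15) p. 393 (the averaging `Q(U)`, its adjoint, its sizes); (3.31)–(3.32)
p. 395 (gauge covariance: a re-basing of the contour transports by unitaries does not change `Q*(U)aQ(U)`); Thm 3.11 p. 416; [5] = Bałaban, *Averaging
operations for lattice gauge theories*, CMP **98** (1985), (139)–(147) pp. 39–40 (the composite averaging is close to a flat average of transported fields).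

WHY THIS FILE (cell `pub-ymgap`, node N06, seat `dag-n06-j` = bundle F5, gen 35; director-ym №375 «R2-A»).  `B9Thm311PosDefAveragingSwap` (✓) transfers row 17
of the N06 certificate to the v10 letter `Node00.deltaAQY` modulo FOUR binders (gap `γ`, sizes `K, K′`, closeness `δ`); `B9Thm311FormGapOfRegYP335AtLettersY` (✓)
supplies `γ` and `B9Eq315QYSizeWeightedL2Y` (✓) supplies `K′ = √(2b₁)` at the letters of record; dag-n06-c's `B9Eq315QLetterL2SizeFromClosenessY` (✓) removes the
size `K` of the new letter (`K = K′ + δ`, triangle inequality — used here BY NAME: `self_le_sq_of_close`).  THIS FILE adds the one remaining freedom the knit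
letter's supplier needs: the reference `Q(U)` may be replaced by ANY row-wise unitary re-basing `Q′` of it
(`(Q′A)(ι) = R(T_ι)((Q(U)A)(ι))` — the Hilbert–Schmidt norms of the rows agree, so `‖Q′A‖_w = ‖Q(U)A‖_w`; this is the form-level content of cell `lit-balaban`'s
`B9B8KnitAveragingClosenessAtCorner.QsY_aY_QY_rebase`), which is the currency in which the knit letter's closeness is naturally proved (corner-tree transports of
a retracted background, dag-n06-l's `B9Eq3115KnitLetterYOnto` §1∕§3).  Result: row 17 at the knit letter, at section-carrying members, from the adjointness of the
pair + ONE closeness display + ONE numeric.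

WHAT IS PROVED (sorry-free; 0 `def`).
* §1 (def-Y's letters): ★ `trIP_w_eq_of_rowRebase` (`(Q′A)(ι) = R(T_ι)((Q(U)A)(ι))`, `T_ι` a contraction pair ⟹ `‖Q′A‖²_w = ‖Q(U)A‖²_w`);
  ★ `trIP_deltaA_swap_abs_sub_le_of_close_rebased` (`|⟨A,Δ_a^𝔮A⟩₁ − ⟨A,Δ_a^{parB}A⟩₁| ≤ δ(2K′+δ)·⟨A,A⟩_wgt` from the size `K′` of `Q_{parB}(U)`, a reference
  `Q′` with the same `w`-form, and the closeness `δ` of `𝔮(U)` to `Q′`); ★★ `posDefTr_deltaAQY_of_formGap_of_close_rebased` (gap `γ` + `K′` + `δ` +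
  `δ(2K′+δ) < γ` ⟹ `PosDefTr 1 (deltaAQY i 𝔮 𝔮s parS Gp U)`; dag-n06-c's `posDefTr_deltaAQY_of_formGap_of_close` is the case `Q′ = Q_{parB}(U)`).
* §2 ★★★ `posDefTr_deltaAQY_of_close_of_regYP335_section` ∕ `posDefTr_deltaAQY_of_close_at_scMemberY`: `∃ M₁ a₁ γ > 0`, at every section-carrying member on
  (3.35), for every pair `(𝔮, 𝔮s)` adjoint at `U`, every reference `Q′` with `(Q′A)(ι) = R(T_ι)((QY parBY U A)(ι))` (`T_ι` contraction pairs) and every `δ ≥ 0` with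
  `‖(𝔮 U − Q′)A‖²_w ≤ δ²·Σ_b c_f²(L^{lev b})⁻²‖A b‖²_HS` and `δ(2√(2b₁) + δ) < γ`: `PosDefTr 1 (deltaAQY x (𝔮) (𝔮s) parSymY (GpY parSymY) U)`.
HONEST SHAPE.  Row 17 at `𝔮 := qKnitOfRecord` = DERIVED at section-carrying members MODULO the ℓ²-closeness of the knit letter to a rebased straight average on the
class (the R2-A estimate; dag-n06-l ∕ J-B lineage) and one x-free numeric; nothing of Thm 3.3∕3.10 at the knit letter claimed; inner-corner members not covered;
NOT a node discharge; count-neutral; nothing continuum ∕ OS ∕ mass gap ∕ Clay.  No `sorry`, no `axiom`, no `instance`, no `notation`, no `def`.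
-/

noncomputable section

namespace Literature.MathematicalPhysics.QuantumFieldTheory.Balaban1983to89.B9Thm311PosDefAveragingSwapClose

open Literature.MathematicalPhysics.QuantumFieldTheory.Balaban1983to89
open B9Thm311ReadingCoords B9Thm39ReadingCoords B9Thm39ReadingAtLetters Node00
open B6KLevelCensusIndexV1 B6Ineq2142KLevelV1 B6GlobalChartV1 B9PinMembersKLevelV1 B9PinGeometryKLevelV1 B9GeoNormsKLevelV1
  B9BackgroundsKLevelV1 B9BackgroundsKLevelV1P B9Thm34Ext
open B9Thm311FormGapOfRegYP335AtLettersY B9Thm311PosDefAveragingSwap B9Eq315QYSizeWeightedL2Y B9Eq315QLetterL2SizeFromClosenessY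
open Literature.MathematicalPhysics.QuantumFieldTheory.Balaban1983to89.B9Thm311DeltaPrimePos (trIP_self_nonneg trIP_self_pos)
open Literature.MathematicalPhysics.QuantumFieldTheory.Balaban1983to89.B9Ineq369CurvatureSmallAtLettersY (hs_nonneg)
open Literature.MathematicalPhysics.QuantumFieldTheory.Balaban1983to89.B9Thm31SiteCoerciveGaugeBlockY (hs_R_eq_of_contraction)
open Literature.MathematicalPhysics.QuantumFieldTheory.Balaban1983to89.B9Thm311FlippedBondForms (trIP_self_eq_sum)
open Literature.MathematicalPhysics.QuantumFieldTheory.Balaban1983to89.B9SectionCarryingMembersV1 (SCMemberY)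
open scoped InnerProductSpace

/-! ## §1 Row-wise unitary re-basing of the reference; the closeness-only bound and positivity transfer at `deltaAQY` -/

section Letters

open scoped Matrix.Norms.L2Operator

variable {d ℓ : ℕ} {hd : 1 ≤ d + 1} {hL : Odd (ℓ + 1) ∧ 1 < ℓ + 1} {b₀ b₁ : ℝ} {N : ℕ}
variable (i : KIdx d ℓ hd hL b₀ b₁) {G : Subgroup (Matrix (Fin N) (Fin N) ℂ)ˣ}

/-- ★ **A ROW-WISE UNITARY RE-BASING OF `Q(U)` HAS THE SAME `w`-FORM**: if `(Q′A)(ι) = R(T_ι)((Q_{parB}(U)A)(ι))` with contraction pairs `|T_ι|, |T_ι⁻¹| ≤ 1`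
(unitary at the record), then `‖Q′A‖²_w = ‖Q_{parB}(U)A‖²_w` — e.g. `Q′ = Q_{parB′}(U)` for a contour table `parB′` obtained from `parB` by index-bond-wise
re-basing (cell `lit-balaban`'s `QsY_aY_QY_rebase` is the operator-level statement for `Q*aQ`). [cite: Balaban1985BackgroundPropagators, (3.31)–(3.32) p.395, (3.13) p.392] -/
theorem trIP_w_eq_of_rowRebase (parB : BondParY (Matrix (Fin N) (Fin N) ℂ) i) (U : CfgY (Matrix (Fin N) (Fin N) ℂ) i)
    (Q' : (FBondY i → Matrix (Fin N) (Fin N) ℂ) →ₗ[ℂ] (IBondY i → Matrix (Fin N) (Fin N) ℂ)) (T : IBondY i → (Matrix (Fin N) (Fin N) ℂ)ˣ)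
    (hT : ∀ ι, ‖(T ι : Matrix (Fin N) (Fin N) ℂ)‖ ≤ 1 ∧ ‖(((T ι)⁻¹ : (Matrix (Fin N) (Fin N) ℂ)ˣ) : Matrix (Fin N) (Fin N) ℂ)‖ ≤ 1)
    (hQ' : ∀ A ι, Q' A ι = B9Eq39Adjoint.R (T ι) (QY i parB U A ι)) (A : FBondY i → Matrix (Fin N) (Fin N) ℂ) :
    trIP i.w (Q' A) (Q' A) = trIP i.w (QY i parB U A) (QY i parB U A) := by
  rw [trIP_self_eq_sum, trIP_self_eq_sum]
  refine Finset.sum_congr rfl fun ι _ => ?_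
  rw [hQ' A ι, hs_R_eq_of_contraction (hT ι)]

/-- ★ **THE CLOSENESS-ONLY MODULUS BOUND**: with the size `‖Q_{parB}(U)A‖²_w ≤ K′²⟨A,A⟩_wgt`, a reference `Q′` of the same `w`-form, and the closeness
`‖(Q − Q′)A‖²_w ≤ δ²⟨A,A⟩_wgt` of the new letter to the reference: `|⟨A, Δ_a^𝔮A⟩₁ − ⟨A, Δ_a^{parB}A⟩₁| ≤ δ(2K′ + δ)·⟨A,A⟩_wgt` (the new letter's own size is
`≤ K′ + δ`, dag-n06-c's `self_le_sq_of_close`). [cite: Balaban1985BackgroundPropagators, (3.26) p.395, (3.13) p.392, (3.15) p.393] -/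
theorem trIP_deltaA_swap_abs_sub_le_of_close_rebased (hG : G ≤ B7Prop2Explicit.unitaryUnits (Matrix (Fin N) (Fin N) ℂ))
    (parS : SiteParY (Matrix (Fin N) (Fin N) ℂ) i) {parB : BondParY (Matrix (Fin N) (Fin N) ℂ) i} (Gp : SiteOpY (Matrix (Fin N) (Fin N) ℂ) i)
    {U : CfgY (Matrix (Fin N) (Fin N) ℂ) i} (hpar : ∀ s s', parB U s s' ∈ G)
    {Q : (FBondY i → Matrix (Fin N) (Fin N) ℂ) →ₗ[ℂ] (IBondY i → Matrix (Fin N) (Fin N) ℂ)}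
    {Qs : (IBondY i → Matrix (Fin N) (Fin N) ℂ) →ₗ[ℂ] (FBondY i → Matrix (Fin N) (Fin N) ℂ)}
    (hQ : IsAdjTr (fun _ => (1 : ℝ)) (fun _ => (1 : ℝ)) Q Qs)
    {Q' : (FBondY i → Matrix (Fin N) (Fin N) ℂ) →ₗ[ℂ] (IBondY i → Matrix (Fin N) (Fin N) ℂ)}
    (hQ' : ∀ A, trIP i.w (Q' A) (Q' A) = trIP i.w (QY i parB U A) (QY i parB U A))
    {wgt : FBondY i → ℝ} (hwgt : ∀ b, 0 < wgt b) {K' δ : ℝ} (hK' : 0 ≤ K') (hδ : 0 ≤ δ)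
    (hsizeY : ∀ A, trIP i.w (QY i parB U A) (QY i parB U A) ≤ K' ^ 2 * trIP wgt A A)
    (hclose : ∀ A, trIP i.w ((Q - Q') A) ((Q - Q') A) ≤ δ ^ 2 * trIP wgt A A)
    (A : FBondY i → Matrix (Fin N) (Fin N) ℂ) :
    |trIP (fun _ => (1 : ℝ)) A ((hessY i U + gradY i U ∘ₗ RY i parS Gp U ∘ₗ divY i U + Qs ∘ₗ aY i ∘ₗ Q) A)
        - trIP (fun _ => (1 : ℝ)) A (deltaAY i parS parB Gp U A)| ≤ δ * (2 * K' + δ) * trIP wgt A A := by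
  rw [trIP_deltaA_swap_sub i hG parS Gp hpar hQ A, ← hQ' A]
  have hn : 0 ≤ trIP wgt A A := trIP_self_nonneg wgt hwgt A
  have hY : trIP i.w (Q' A) (Q' A) ≤ K' ^ 2 * trIP wgt A A := by rw [hQ' A]; exact hsizeY A
  have hXY : trIP i.w (Q A - Q' A) (Q A - Q' A) ≤ δ ^ 2 * trIP wgt A A := by
    have h := hclose A
    rwa [LinearMap.sub_apply] at h
  have hX : trIP i.w (Q A) (Q A) ≤ (K' + δ) ^ 2 * trIP wgt A A := self_le_sq_of_close i.hw (Q A) (Q' A) hn hK' hδ hY hXY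
  have h := abs_self_sub_self_le_of_sq_le i.hw (Q A) (Q' A) hn (by positivity : 0 ≤ K' + δ) hK' hδ hX hY hXY
  calc |trIP i.w (Q A) (Q A) - trIP i.w (Q' A) (Q' A)| ≤ δ * (K' + δ + K') * trIP wgt A A := h
    _ = δ * (2 * K' + δ) * trIP wgt A A := by ring

/-- ★★ **POSITIVITY TRANSFER AT `deltaAQY`, CLOSENESS-ONLY FORM**: a form gap `γ·⟨A,A⟩_wgt ≤ ⟨A, Δ_a^{parB}(U)A⟩₁`, the size `K′` of `Q_{parB}(U)`, a
reference `Q′` with the same `w`-form, the closeness `δ` of `𝔮 U` to `Q′`, and `δ(2K′ + δ) < γ` give `PosDefTr 1 (deltaAQY i 𝔮 𝔮s parS Gp U)` for every pair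
`(𝔮, 𝔮s)` adjoint at `U`. [cite: Balaban1985BackgroundPropagators, Thm 3.11 p.416, (3.26) p.395] -/
theorem posDefTr_deltaAQY_of_formGap_of_close_rebased (hG : G ≤ B7Prop2Explicit.unitaryUnits (Matrix (Fin N) (Fin N) ℂ))
    (parS : SiteParY (Matrix (Fin N) (Fin N) ℂ) i) {parB : BondParY (Matrix (Fin N) (Fin N) ℂ) i} (Gp : SiteOpY (Matrix (Fin N) (Fin N) ℂ) i)
    {U : CfgY (Matrix (Fin N) (Fin N) ℂ) i} (hpar : ∀ s s', parB U s s' ∈ G)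
    {𝔮 : CfgY (Matrix (Fin N) (Fin N) ℂ) i → ((FBondY i → Matrix (Fin N) (Fin N) ℂ) →ₗ[ℂ] (IBondY i → Matrix (Fin N) (Fin N) ℂ))}
    {𝔮s : CfgY (Matrix (Fin N) (Fin N) ℂ) i → ((IBondY i → Matrix (Fin N) (Fin N) ℂ) →ₗ[ℂ] (FBondY i → Matrix (Fin N) (Fin N) ℂ))}
    (hQ : IsAdjTr (fun _ => (1 : ℝ)) (fun _ => (1 : ℝ)) (𝔮 U) (𝔮s U))
    {Q' : (FBondY i → Matrix (Fin N) (Fin N) ℂ) →ₗ[ℂ] (IBondY i → Matrix (Fin N) (Fin N) ℂ)}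
    (hQ' : ∀ A, trIP i.w (Q' A) (Q' A) = trIP i.w (QY i parB U A) (QY i parB U A))
    {wgt : FBondY i → ℝ} (hwgt : ∀ b, 0 < wgt b) {γ K' δ : ℝ} (hK' : 0 ≤ K') (hδ : 0 ≤ δ)
    (hgap : ∀ A, γ * trIP wgt A A ≤ trIP (fun _ => (1 : ℝ)) A (deltaAY i parS parB Gp U A))
    (hsizeY : ∀ A, trIP i.w (QY i parB U A) (QY i parB U A) ≤ K' ^ 2 * trIP wgt A A)
    (hclose : ∀ A, trIP i.w ((𝔮 U - Q') A) ((𝔮 U - Q') A) ≤ δ ^ 2 * trIP wgt A A) (hβ : δ * (2 * K' + δ) < γ) :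
    PosDefTr (fun _ => (1 : ℝ)) (deltaAQY i 𝔮 𝔮s parS Gp U) :=
  posDefTr_of_formGap_of_abs_sub_le hwgt hgap
    (fun A => trIP_deltaA_swap_abs_sub_le_of_close_rebased i hG parS Gp hpar hQ hQ' hwgt hK' hδ hsizeY hclose A) hβ

end Letters

/-! ## §2 ★★★ Row 17 at the knit-shaped letter from ONE closeness display, at section-carrying members -/

section Record

open scoped Matrix.Norms.L2Operator
open B7Prop2SpecialUnitary

variable {N : ℕ} (θ : Stage3Params) (Mstar : ℕ)

/-- ★★★ **ROW 17 AT `deltaAQY … (parSymY) (GpY parSymY)` FROM ADJOINTNESS + ONE CLOSENESS + ONE NUMERIC**, on print's class (3.35) at every section-carrying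
member above one threshold: there are `M₁, a₁, γ > 0` such that for `β` onto, `M₁ ≦ M`, `0 < α₀`, `M·α₀ ≦ a₁`, `U ∈ (bg9YP … x).Reg335 c₃₅ α₀`, every pair
`(𝔮, 𝔮s)` adjoint at `U`, every reference `Q′` that is a row-wise contraction re-basing of `QY parBY U` (`(Q′A)(ι) = R(T_ι)((QY parBY U A)(ι))`), and every
`δ ≥ 0` with `‖(𝔮 U − Q′)A‖²_w ≤ δ²·Σ_b c_f²(L^{lev b})⁻²‖A b‖²_HS` for all `A` and `δ(2√(2b₁) + δ) < γ`: `PosDefTr 1 (deltaAQY x 𝔮 𝔮s parSymY (GpY parSymY) U)`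
(`γ` of `formGap_deltaAY_of_regYP335_section`; `K′ = √(2b₁)` by `trIP_w_QY_parBY_le_member`).
[cite: Balaban1985BackgroundPropagators, Thm 3.11 p.416; Thm 3.3 p.399; (3.26) p.395; (3.15) p.393; (3.31)–(3.32) p.395] -/
theorem posDefTr_deltaAQY_of_close_of_regYP335_section (hN : 1 ≤ N) :
    ∃ M₁ a₁ γ : ℝ, 0 < M₁ ∧ 0 < a₁ ∧ 0 < γ ∧
    ∀ (x : MemberY θ.d₆ θ.ℓ₆ θ.hd' θ.hL' θ.b₀ θ.b₁ Mstar), Function.Surjective (β x.hN x.D x.hk) → M₁ ≤ (geo9Y x).M →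
      ∀ α₀ : ℝ, 0 < α₀ → (geo9Y x).M * α₀ ≤ a₁ →
      ∀ U : CfgY (Matrix (Fin N) (Fin N) ℂ) x.toKIdx,
        (bg9YP (Matrix (Fin N) (Fin N) ℂ) (specialUnitaryUnits (Fin N)) x).Reg335 c35Y α₀ U →
        ∀ (𝔮 : CfgY (Matrix (Fin N) (Fin N) ℂ) x.toKIdx →
              ((FBondY x.toKIdx → Matrix (Fin N) (Fin N) ℂ) →ₗ[ℂ] (IBondY x.toKIdx → Matrix (Fin N) (Fin N) ℂ)))
          (𝔮s : CfgY (Matrix (Fin N) (Fin N) ℂ) x.toKIdx →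
              ((IBondY x.toKIdx → Matrix (Fin N) (Fin N) ℂ) →ₗ[ℂ] (FBondY x.toKIdx → Matrix (Fin N) (Fin N) ℂ))),
          IsAdjTr (fun _ => (1 : ℝ)) (fun _ => (1 : ℝ)) (𝔮 U) (𝔮s U) →
        ∀ (Q' : (FBondY x.toKIdx → Matrix (Fin N) (Fin N) ℂ) →ₗ[ℂ] (IBondY x.toKIdx → Matrix (Fin N) (Fin N) ℂ))
          (T : IBondY x.toKIdx → (Matrix (Fin N) (Fin N) ℂ)ˣ),
          (∀ ι, ‖(T ι : Matrix (Fin N) (Fin N) ℂ)‖ ≤ 1 ∧ ‖(((T ι)⁻¹ : (Matrix (Fin N) (Fin N) ℂ)ˣ) : Matrix (Fin N) (Fin N) ℂ)‖ ≤ 1) →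
          (∀ A ι, Q' A ι = B9Eq39Adjoint.R (T ι) (QY x.toKIdx (parBY x.toKIdx) U A ι)) →
        ∀ δ : ℝ, 0 ≤ δ →
          (∀ A, trIP x.toKIdx.w ((𝔮 U - Q') A) ((𝔮 U - Q') A)
              ≤ δ ^ 2 * ∑ b, (x.toKIdx.cf ^ 2 * ((((θ.ℓ₆ : ℝ) + 1) ^ levV1 x.toKIdx b.src)⁻¹) ^ 2) * ∑ a, ∑ c, ‖A b a c‖ ^ 2) →
          δ * (2 * Real.sqrt (2 * θ.b₁) + δ) < γ →
          PosDefTr (fun _ => (1 : ℝ)) (deltaAQY x.toKIdx 𝔮 𝔮s (parSymY x.toKIdx) (GpY x.toKIdx (parSymY x.toKIdx)) U) := by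
  obtain ⟨M₁, a₁, γ, hM₁, ha₁, hγ, h⟩ := formGap_deltaAY_of_regYP335_section (N := N) θ Mstar hN
  refine ⟨M₁, a₁, γ, hM₁, ha₁, hγ, fun x hsurj hM α₀ hα ha U hU 𝔮 𝔮s hQ Q' T hT hQ' δ hδ hclose hβ => ?_⟩
  have hG : specialUnitaryUnits (Fin N) ≤ B7Prop2Explicit.unitaryUnits (Matrix (Fin N) (Fin N) ℂ) := specialUnitaryUnits_le_unitaryUnits
  have hUG : ∀ μ z, U μ z ∈ specialUnitaryUnits (Fin N) := hU.1.1
  have hwgt : ∀ b : FBondY x.toKIdx, 0 < x.toKIdx.cf ^ 2 * ((((θ.ℓ₆ : ℝ) + 1) ^ levV1 x.toKIdx b.src)⁻¹) ^ 2 := by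
    intro b
    have hcf : x.toKIdx.cf ≠ 0 := x.toKIdx.hcf
    have hL : (0 : ℝ) < ((θ.ℓ₆ : ℝ) + 1) ^ levV1 x.toKIdx b.src := pow_pos (by positivity) _
    positivity
  have hwsum : ∀ A : FBondY x.toKIdx → Matrix (Fin N) (Fin N) ℂ,
      trIP (fun b => x.toKIdx.cf ^ 2 * ((((θ.ℓ₆ : ℝ) + 1) ^ levV1 x.toKIdx b.src)⁻¹) ^ 2) A A
        = ∑ b, (x.toKIdx.cf ^ 2 * ((((θ.ℓ₆ : ℝ) + 1) ^ levV1 x.toKIdx b.src)⁻¹) ^ 2) * ∑ a, ∑ c, ‖A b a c‖ ^ 2 :=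
    fun A => trIP_self_eq_sum _ A
  refine posDefTr_deltaAQY_of_formGap_of_close_rebased x.toKIdx hG (parSymY x.toKIdx) (GpY x.toKIdx (parSymY x.toKIdx))
    (fun s s' => parBY_mem x.toKIdx hUG s s') hQ
    (fun A => trIP_w_eq_of_rowRebase x.toKIdx (parBY x.toKIdx) U Q' T hT hQ' A)
    hwgt (Real.sqrt_nonneg _) hδ (fun A => ?_) (fun A => ?_) (fun A => ?_) hβ
  · rw [hwsum]; exact h x hsurj hM α₀ hα ha U hU A
  · rw [hwsum]; exact trIP_w_QY_parBY_le_member θ Mstar x hUG A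
  · rw [hwsum]; exact hclose A

/-- ★★★ **THE SAME AT `SCMemberY` BY NAME** (n06-c's carrier of section-carrying members). [cite: Balaban1985BackgroundPropagators, Thm 3.11 p.416; Balaban1984PropagatorsII, (2.45) p.231] -/
theorem posDefTr_deltaAQY_of_close_at_scMemberY (hN : 1 ≤ N) :
    ∃ M₁ a₁ γ : ℝ, 0 < M₁ ∧ 0 < a₁ ∧ 0 < γ ∧
    ∀ (j : SCMemberY θ.d₆ θ.ℓ₆ θ.hd' θ.hL' θ.b₀ θ.b₁ Mstar), M₁ ≤ (geo9Y j.val).M →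
      ∀ α₀ : ℝ, 0 < α₀ → (geo9Y j.val).M * α₀ ≤ a₁ →
      ∀ U : CfgY (Matrix (Fin N) (Fin N) ℂ) j.val.toKIdx,
        (bg9YP (Matrix (Fin N) (Fin N) ℂ) (specialUnitaryUnits (Fin N)) j.val).Reg335 c35Y α₀ U →
        ∀ (𝔮 : CfgY (Matrix (Fin N) (Fin N) ℂ) j.val.toKIdx →
              ((FBondY j.val.toKIdx → Matrix (Fin N) (Fin N) ℂ) →ₗ[ℂ] (IBondY j.val.toKIdx → Matrix (Fin N) (Fin N) ℂ)))
          (𝔮s : CfgY (Matrix (Fin N) (Fin N) ℂ) j.val.toKIdx →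
              ((IBondY j.val.toKIdx → Matrix (Fin N) (Fin N) ℂ) →ₗ[ℂ] (FBondY j.val.toKIdx → Matrix (Fin N) (Fin N) ℂ))),
          IsAdjTr (fun _ => (1 : ℝ)) (fun _ => (1 : ℝ)) (𝔮 U) (𝔮s U) →
        ∀ (Q' : (FBondY j.val.toKIdx → Matrix (Fin N) (Fin N) ℂ) →ₗ[ℂ] (IBondY j.val.toKIdx → Matrix (Fin N) (Fin N) ℂ))
          (T : IBondY j.val.toKIdx → (Matrix (Fin N) (Fin N) ℂ)ˣ),
          (∀ ι, ‖(T ι : Matrix (Fin N) (Fin N) ℂ)‖ ≤ 1 ∧ ‖(((T ι)⁻¹ : (Matrix (Fin N) (Fin N) ℂ)ˣ) : Matrix (Fin N) (Fin N) ℂ)‖ ≤ 1) →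
          (∀ A ι, Q' A ι = B9Eq39Adjoint.R (T ι) (QY j.val.toKIdx (parBY j.val.toKIdx) U A ι)) →
        ∀ δ : ℝ, 0 ≤ δ →
          (∀ A, trIP j.val.toKIdx.w ((𝔮 U - Q') A) ((𝔮 U - Q') A)
              ≤ δ ^ 2 * ∑ b, (j.val.toKIdx.cf ^ 2 * ((((θ.ℓ₆ : ℝ) + 1) ^ levV1 j.val.toKIdx b.src)⁻¹) ^ 2) * ∑ a, ∑ c, ‖A b a c‖ ^ 2) →
          δ * (2 * Real.sqrt (2 * θ.b₁) + δ) < γ →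
          PosDefTr (fun _ => (1 : ℝ)) (deltaAQY j.val.toKIdx 𝔮 𝔮s (parSymY j.val.toKIdx) (GpY j.val.toKIdx (parSymY j.val.toKIdx)) U) := by
  obtain ⟨M₁, a₁, γ, hM₁, ha₁, hγ, h⟩ := posDefTr_deltaAQY_of_close_of_regYP335_section (N := N) θ Mstar hN
  exact ⟨M₁, a₁, γ, hM₁, ha₁, hγ, fun j hM α₀ hα ha U hU 𝔮 𝔮s hQ Q' T hT hQ' δ hδ hclose hβ =>
    h j.val j.surjective_beta hM α₀ hα ha U hU 𝔮 𝔮s hQ Q' T hT hQ' δ hδ hclose hβ⟩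

end Record

end Literature.MathematicalPhysics.QuantumFieldTheory.Balaban1983to89.B9Thm311PosDefAveragingSwapClose

end
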